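import Mathlib
import HarnessLib
import Summits.ValiantsHypothesis.ValiantsHypothesis.Theorems.LacunarySymmetroidMatrixDescartesProductPlusOneEulerSectorsTop

/-!
# ValiantsHypothesis / LacunarySymmetroid — crux `MatrixDescartes` (stmt-ValiantsHypothesis-18050, V1),
# LINE (A) «product_plus_one», S5 / floor at the bottom coupling, EVERY FORMAT `K`: letter-partial sums and type-β windows

Every-`K` form of ✓ `…ProductPlusOneABWindow` (val-idea-25 g3's AB-reduction, there `K = 3`); the every-`K` identity AB0 and the
antitonicity AB1 also exist, in a different shape (exponent table `e` with `e i₀ = 0`, sign disjunction per row), in val-lit-p7 g15's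
✓ `…ProductPlusOneLetterSumsK` — the NEW content here is the COUNT (K3) on type-β windows for every format, stated self-containedly in the
line's `d`/`a` currency.  Setting: `K ≥ 3` letters, strictly increasing
support `d`, BOTTOM coupling `l₀ = 0`, rows `f_j(x) = Σ_l a_{jl} x^{d_l}`, reduced rows `G_j(x) = Σ_l a_{jl} x^{d_l − d_0}`, gaps `e_l = d_l − d_0`,
UPPER-SIGNED company: `a_{jl}·a_{jl'} ≥ 0` for all `l, l' ≥ 1` (every coefficient above the bottom letter weakly of one sign per row; the bottom
coefficient free) — the every-`K` version of the T1 ∪ T5 companies.  Off the poles: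

* (K0) `eulerSumK_eq_letterSums` — `Σ_j Φ_j(x) = Σ_l e_l·x^{e_l}·A_l(x)` with the LETTER-PARTIAL SUMS `A_l(x) = Σ_j a_{jl}/G_j(x)`, and
  `eulerNumeratorK_eval_eq_zero_iff` — `R(x) = 0 ⟺ Σ_l e_l x^{e_l} A_l(x) = 0`;
* (K1) `theta_reducedRow`, `antitoneOn_letterSumK` — for upper-signed rows EVERY `A_l` with `l ≥ 1` is antitone on every pole-free interval
  `[u,v] ⊂ (0,∞)` (`(a_l/G)′ = −a_l G′/G²`, `x·a_l·G′ = Σ_{l'} e_{l'} a_l a_{l'} x^{e_{l'}} ≥ 0`; no ratio condition);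
* (K3) ★ `eulerNumeratorK_roots_Icc_le_one_of_letterSums_pos` — if `A_l > 0` on the pole-free interval for every MIDDLE letter
  `1 ≤ l ≤ K−2`, then `eulerNumerator d a 0` has AT MOST ONE zero there (`Σ_{l} e_l x^{−(e_{K−1}−e_l)} A_l` strictly antitone);
  ★ `eulerNumeratorK_roots_Icc_le_one_of_letterSums_neg` — if `A_l < 0` on it for every letter `l ≥ 2`, the same conclusion
  (`Σ_l e_l x^{e_l − e_1} A_l` strictly antitone).  At `K = 3` these are the two cases of ✓ `…ABWindow` (`A₁ > 0`, resp. `A₂ < 0`).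

HONEST FRAMING: located helper lemmas (type-α windows = the riser budget, research); NOT `stub_polyLaw`, not `OneChangeFloorK3`, not
`stub_classRowK3`, not `MatrixDescartes`, not Conjecture B; `VP ≠ VNP` is NOT proved.  No definitions, no named facts.
-/

set_option linter.dupNamespace false

namespace Summit.ValiantsHypothesis.ValiantsHypothesis.Theorems.LacunarySymmetroidMatrixDescartes

namespace ProductPlusOne

open Polynomial Finset
open scoped BigOperators

/-! ### K0 — rows, reduced rows and the Euler sum through the letter-partial sums -/

/-- `f_j(x) = x^{d_0}·G_j(x)` for a strictly increasing support. [folklore] -/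
theorem row_eq_pow_mul_reducedRow {K : ℕ} (hK : 1 ≤ K) (d : Fin K → ℕ) (hd : StrictMono d) (b : Fin K → ℝ) (x : ℝ) :
    (∑ l, b l * x ^ (d l)) = x ^ (d ⟨0, by omega⟩) * ∑ l, b l * x ^ (d l - d ⟨0, by omega⟩) := by
  rw [Finset.mul_sum]
  refine Finset.sum_congr rfl fun l _ => ?_
  have hle : d ⟨0, by omega⟩ ≤ d l := hd.monotone (Fin.mk_le_mk.mpr (Nat.zero_le _) : (⟨0, by omega⟩ : Fin K) ≤ l)
  rw [mul_left_comm, ← pow_add, Nat.add_sub_cancel' hle]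

/-- `x·G′(x) = Σ_l e_l a_l x^{e_l}` for the reduced row (`e_l = d_l − d_0`). [folklore] -/
theorem hasDerivAt_reducedRow {K : ℕ} (hK : 1 ≤ K) (d : Fin K → ℕ) (b : Fin K → ℝ) (x : ℝ) :
    HasDerivAt (fun y => ∑ l, b l * y ^ (d l - d ⟨0, by omega⟩))
      (∑ l, b l * (((d l - d ⟨0, by omega⟩ : ℕ) : ℝ) * x ^ (d l - d ⟨0, by omega⟩ - 1))) x := by
  refine HasDerivAt.fun_sum fun l _ => ?_
  exact (hasDerivAt_pow _ x).const_mul (b l)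

/-- The `θ`-form of the previous derivative: `x·G′(x) = Σ_l e_l a_l x^{e_l}`. [folklore] -/
theorem theta_reducedRow {K : ℕ} (hK : 1 ≤ K) (d : Fin K → ℕ) (b : Fin K → ℝ) (x : ℝ) :
    x * ∑ l, b l * (((d l - d ⟨0, by omega⟩ : ℕ) : ℝ) * x ^ (d l - d ⟨0, by omega⟩ - 1))
      = ∑ l, ((d l - d ⟨0, by omega⟩ : ℕ) : ℝ) * b l * x ^ (d l - d ⟨0, by omega⟩) := by
  rw [Finset.mul_sum]
  refine Finset.sum_congr rfl fun l _ => ?_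
  rcases Nat.eq_zero_or_pos (d l - d ⟨0, by omega⟩) with h | h
  · rw [h]; simp
  · obtain ⟨n, hn⟩ : ∃ n, d l - d ⟨0, by omega⟩ = n + 1 := ⟨_, (Nat.succ_pred_eq_of_pos h).symm⟩
    rw [hn, Nat.add_sub_cancel, pow_succ]
    ring

/-- **(K0)** For `x > 0`, `Σ_j (X f_j′ − d_0 f_j)(x)/f_j(x) = Σ_l e_l x^{e_l}·A_l(x)` with `A_l = Σ_j a_{jl}/G_j` (at a pole both sides use the
`x/0 = 0` convention consistently). [folklore] -/
theorem eulerSumK_eq_letterSums {m K : ℕ} (hK : 1 ≤ K) (d : Fin K → ℕ) (hd : StrictMono d) (a : Fin m → Fin K → ℝ) {x : ℝ}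
    (hx : 0 < x) :
    (∑ j, (∑ l, a j l * ((d l : ℝ) - d ⟨0, by omega⟩) * x ^ (d l)) / (∑ l, a j l * x ^ (d l)))
      = ∑ l, ((d l - d ⟨0, by omega⟩ : ℕ) : ℝ) * x ^ (d l - d ⟨0, by omega⟩)
          * ∑ j, a j l / (∑ l', a j l' * x ^ (d l' - d ⟨0, by omega⟩)) := by
  have hx0 : x ^ (d ⟨0, by omega⟩) ≠ 0 := pow_ne_zero _ hx.ne'
  -- numerator and denominator both carry `x^{d_0}`
  have hrow : ∀ j, (∑ l, a j l * ((d l : ℝ) - d ⟨0, by omega⟩) * x ^ (d l)) / (∑ l, a j l * x ^ (d l))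
      = ∑ l, ((d l - d ⟨0, by omega⟩ : ℕ) : ℝ) * x ^ (d l - d ⟨0, by omega⟩)
          * (a j l / (∑ l', a j l' * x ^ (d l' - d ⟨0, by omega⟩))) := by
    intro j
    rw [row_eq_pow_mul_reducedRow hK d hd (a j) x]
    have hnum : (∑ l, a j l * ((d l : ℝ) - d ⟨0, by omega⟩) * x ^ (d l))
        = x ^ (d ⟨0, by omega⟩) * ∑ l, ((d l - d ⟨0, by omega⟩ : ℕ) : ℝ) * a j l * x ^ (d l - d ⟨0, by omega⟩) := by
      rw [Finset.mul_sum]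
      refine Finset.sum_congr rfl fun l _ => ?_
      have hle : d ⟨0, by omega⟩ ≤ d l := hd.monotone (Fin.mk_le_mk.mpr (Nat.zero_le _) : (⟨0, by omega⟩ : Fin K) ≤ l)
      rw [Nat.cast_sub hle]
      have : x ^ (d l) = x ^ (d ⟨0, by omega⟩) * x ^ (d l - d ⟨0, by omega⟩) := by
        rw [← pow_add, Nat.add_sub_cancel' hle]
      rw [this]; ring
    rw [hnum, mul_div_mul_left _ _ hx0, Finset.sum_div]
    refine Finset.sum_congr rfl fun l _ => ?_
    ring
  rw [Finset.sum_congr rfl fun j _ => hrow j, Finset.sum_comm]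
  refine Finset.sum_congr rfl fun l _ => ?_
  rw [Finset.mul_sum]

/-- **(K0′)** The c-free Euler numerator at the bottom coupling vanishes at `x > 0` off the poles iff `Σ_l e_l x^{e_l} A_l(x) = 0`.
[folklore] -/
theorem eulerNumeratorK_eval_eq_zero_iff {m K : ℕ} (hK : 1 ≤ K) (d : Fin K → ℕ) (hd : StrictMono d) (a : Fin m → Fin K → ℝ)
    {x : ℝ} (hx : 0 < x) (hG : ∀ j, (∑ l, a j l * x ^ (d l - d ⟨0, by omega⟩)) ≠ 0) :
    (∑ j, (∑ l, C (a j l * ((d l : ℝ) - d ⟨0, by omega⟩)) * X ^ (d l)) *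
      ∏ i ∈ Finset.univ.erase j, (∑ l, C (a i l) * X ^ (d l)) : ℝ[X]).eval x = 0 ↔
    (∑ l, ((d l - d ⟨0, by omega⟩ : ℕ) : ℝ) * x ^ (d l - d ⟨0, by omega⟩)
        * ∑ j, a j l / (∑ l', a j l' * x ^ (d l' - d ⟨0, by omega⟩))) = 0 := by
  classical
  have hx0 : x ^ (d ⟨0, by omega⟩) ≠ 0 := pow_ne_zero _ hx.ne'
  have hf : ∀ j, (∑ l, a j l * x ^ (d l)) ≠ 0 := by
    intro j h
    rw [row_eq_pow_mul_reducedRow hK d hd (a j) x] at h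
    exact (mul_ne_zero hx0 (hG j)) h
  rw [eval_eulerNumerator]
  -- `R(x) = (∏ f_i(x)) · Σ_j N_j(x)/f_j(x)`
  have hsplit : (∑ j, (∑ l, a j l * ((d l : ℝ) - d ⟨0, by omega⟩) * x ^ (d l)) * ∏ i ∈ Finset.univ.erase j, (∑ l, a i l * x ^ (d l)))
      = (∏ i, (∑ l, a i l * x ^ (d l))) *
        ∑ j, (∑ l, a j l * ((d l : ℝ) - d ⟨0, by omega⟩) * x ^ (d l)) / (∑ l, a j l * x ^ (d l)) := by
    rw [Finset.mul_sum]
    refine Finset.sum_congr rfl fun j _ => ?_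
    rw [← Finset.mul_prod_erase Finset.univ (fun i => ∑ l, a i l * x ^ (d l)) (Finset.mem_univ j)]
    have hfj := hf j
    field_simp
  rw [hsplit, mul_eq_zero, or_iff_right (Finset.prod_ne_zero_iff.2 fun j _ => hf j), eulerSumK_eq_letterSums hK d hd a hx]

/-! ### K1 — every upper letter-partial sum is antitone for upper-signed rows -/

/-- One term `c/G_j` with `c·(x G_j′(x)) ≥ 0` on a pole-free interval is antitone there. [folklore] -/
theorem antitoneOn_letterTermK {K : ℕ} (hK : 1 ≤ K) (d : Fin K → ℕ) (b : Fin K → ℝ) (c : ℝ) {u v : ℝ} (hu : 0 < u)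
    (hG : ∀ x ∈ Set.Icc u v, (∑ l, b l * x ^ (d l - d ⟨0, by omega⟩)) ≠ 0)
    (hnum : ∀ x ∈ Set.Icc u v, 0 ≤ c * ∑ l, ((d l - d ⟨0, by omega⟩ : ℕ) : ℝ) * b l * x ^ (d l - d ⟨0, by omega⟩)) :
    AntitoneOn (fun y => c / ∑ l, b l * y ^ (d l - d ⟨0, by omega⟩)) (Set.Icc u v) := by
  have hderiv : ∀ x ∈ Set.Icc u v, HasDerivAt (fun y => c / ∑ l, b l * y ^ (d l - d ⟨0, by omega⟩))
      (-(c * ∑ l, b l * (((d l - d ⟨0, by omega⟩ : ℕ) : ℝ) * x ^ (d l - d ⟨0, by omega⟩ - 1)))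
        / (∑ l, b l * x ^ (d l - d ⟨0, by omega⟩)) ^ 2) x := by
    intro x hx
    have hg' := hasDerivAt_reducedRow hK d b x
    have h := (hg'.inv (hG x hx)).const_mul c
    have hfun : (fun y => c / ∑ l, b l * y ^ (d l - d ⟨0, by omega⟩))
        = fun y => c * (∑ l, b l * y ^ (d l - d ⟨0, by omega⟩))⁻¹ := by
      funext y; rw [div_eq_mul_inv]
    rw [hfun]
    refine h.congr_deriv ?_
    ring
  refine antitoneOn_of_deriv_nonpos (convex_Icc u v) ?_ ?_ ?_
  · exact fun x hx => (hderiv x hx).continuousAt.continuousWithinAt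
  · rw [interior_Icc]
    exact fun x hx => (hderiv x (Set.Ioo_subset_Icc_self hx)).differentiableAt.differentiableWithinAt
  · rw [interior_Icc]
    intro x hx
    have hxI := Set.Ioo_subset_Icc_self hx
    have hx0 : 0 < x := hu.trans_le hxI.1
    rw [(hderiv x hxI).deriv]
    refine div_nonpos_of_nonpos_of_nonneg (neg_nonpos.mpr ?_) (sq_nonneg _)
    -- `c·G′(x) = (c·x G′(x))/x ≥ 0`
    have h := hnum x hxI
    rw [← theta_reducedRow hK d b x] at h
    have : c * ∑ l, b l * (((d l - d ⟨0, by omega⟩ : ℕ) : ℝ) * x ^ (d l - d ⟨0, by omega⟩ - 1))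
        = (c * (x * ∑ l, b l * (((d l - d ⟨0, by omega⟩ : ℕ) : ℝ) * x ^ (d l - d ⟨0, by omega⟩ - 1)))) / x := by
      field_simp
    rw [this]
    exact div_nonneg h hx0.le

/-- **(K1)** For UPPER-SIGNED rows (`a_{jl} a_{jl'} ≥ 0` for all `l, l' ≥ 1`) every letter-partial sum `A_l = Σ_j a_{jl}/G_j` with `l ≥ 1`
is antitone on every pole-free interval `[u,v] ⊂ (0,∞)`. [folklore; AB1 for every K] -/
theorem antitoneOn_letterSumK {m K : ℕ} (hK : 1 ≤ K) (d : Fin K → ℕ) (a : Fin m → Fin K → ℝ)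
    (hus : ∀ j (l l' : Fin K), 0 < (l : ℕ) → 0 < (l' : ℕ) → 0 ≤ a j l * a j l') (l : Fin K) (hl : 0 < (l : ℕ))
    {u v : ℝ} (hu : 0 < u) (hG : ∀ x ∈ Set.Icc u v, ∀ j, (∑ l', a j l' * x ^ (d l' - d ⟨0, by omega⟩)) ≠ 0) :
    AntitoneOn (fun y => ∑ j, a j l / ∑ l', a j l' * y ^ (d l' - d ⟨0, by omega⟩)) (Set.Icc u v) := by
  intro x hx y hy hxy
  refine Finset.sum_le_sum fun j _ => antitoneOn_letterTermK hK d (a j) (a j l) hu (fun z hz => hG z hz j) ?_ hx hy hxy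
  intro z hz
  have hz0 : 0 < z := hu.trans_le hz.1
  rw [Finset.mul_sum]
  refine Finset.sum_nonneg fun l' _ => ?_
  rcases Nat.eq_zero_or_pos (l' : ℕ) with h0 | hpos
  · -- the bottom letter carries the factor `e_0 = 0`
    have : l' = ⟨0, by omega⟩ := Fin.ext h0
    rw [this, Nat.sub_self]
    simp
  · have := hus j l l' hl hpos
    have hpow : 0 ≤ z ^ (d l' - d ⟨0, by omega⟩) := pow_nonneg hz0.le _
    have hcast : 0 ≤ ((d l' - d ⟨0, by omega⟩ : ℕ) : ℝ) := Nat.cast_nonneg _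
    have : a j l * (((d l' - d ⟨0, by omega⟩ : ℕ) : ℝ) * a j l' * z ^ (d l' - d ⟨0, by omega⟩))
        = ((d l' - d ⟨0, by omega⟩ : ℕ) : ℝ) * (a j l * a j l') * z ^ (d l' - d ⟨0, by omega⟩) := by ring
    rw [this]
    exact mul_nonneg (mul_nonneg hcast ‹0 ≤ a j l * a j l'›) hpow

/-! ### K3 — at most one zero on the every-K type-β windows -/

/-- ★ **(K3, middle letter sums positive)** `K ≥ 3`, strictly increasing support, UPPER-SIGNED company, pole-free interval `[u,v] ⊂ (0,∞)`
on which `A_l > 0` for every middle letter `1 ≤ l ≤ K−2`: the c-free Euler numerator at the bottom coupling has AT MOST ONE zero in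
`[u,v]`. [this file's theorem] -/
theorem eulerNumeratorK_roots_Icc_le_one_of_letterSums_pos {m K : ℕ} (hK : 3 ≤ K) (d : Fin K → ℕ) (hd : StrictMono d)
    (a : Fin m → Fin K → ℝ) (hus : ∀ j (l l' : Fin K), 0 < (l : ℕ) → 0 < (l' : ℕ) → 0 ≤ a j l * a j l')
    {u v : ℝ} (hu : 0 < u) (hG : ∀ x ∈ Set.Icc u v, ∀ j, (∑ l', a j l' * x ^ (d l' - d ⟨0, by omega⟩)) ≠ 0)
    (hA : ∀ x ∈ Set.Icc u v, ∀ l : Fin K, 0 < (l : ℕ) → (l : ℕ) < K - 1 →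
      0 < ∑ j, a j l / ∑ l', a j l' * x ^ (d l' - d ⟨0, by omega⟩)) :
    ((∑ j, (∑ l, C (a j l * ((d l : ℝ) - d ⟨0, by omega⟩)) * X ^ (d l)) *
      ∏ i ∈ Finset.univ.erase j, (∑ l, C (a i l) * X ^ (d l)) : ℝ[X]).roots.toFinset.filter (fun t => u ≤ t ∧ t ≤ v)).card ≤ 1 := by
  classical
  set top : Fin K := ⟨K - 1, by omega⟩ with htop
  set A : Fin K → ℝ → ℝ := fun l y => ∑ j, a j l / ∑ l', a j l' * y ^ (d l' - d ⟨0, by omega⟩) with hAdef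
  -- the normalised function `Ξ(x) = Σ_l e_l (x^{d_top − d_l})⁻¹ A_l(x)`
  set Ξ : ℝ → ℝ := fun y => ∑ l, ((d l - d ⟨0, by omega⟩ : ℕ) : ℝ) * (y ^ (d top - d l))⁻¹ * A l y with hΞ
  have hletop : ∀ l : Fin K, d l ≤ d top := fun l =>
    hd.monotone (Fin.mk_le_mk.mpr (by have := l.isLt; omega) : l ≤ top)
  have hΞrel : ∀ x, 0 < x → (∑ l, ((d l - d ⟨0, by omega⟩ : ℕ) : ℝ) * x ^ (d l - d ⟨0, by omega⟩) * A l x)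
      = x ^ (d top - d ⟨0, by omega⟩) * Ξ x := by
    intro x hx
    rw [hΞ, Finset.mul_sum]
    refine Finset.sum_congr rfl fun l _ => ?_
    have hl0 : d ⟨0, by omega⟩ ≤ d l := hd.monotone (Fin.mk_le_mk.mpr (Nat.zero_le _) : (⟨0, by omega⟩ : Fin K) ≤ l)
    have hpow : x ^ (d top - d ⟨0, by omega⟩) = x ^ (d l - d ⟨0, by omega⟩) * x ^ (d top - d l) := by
      rw [← pow_add]; congr 1; have := hletop l; omega
    have hxp : x ^ (d top - d l) ≠ 0 := pow_ne_zero _ hx.ne'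
    rw [hpow]; field_simp
  -- `Ξ` is strictly antitone on `[u,v]`
  have hΞanti : ∀ x ∈ Set.Icc u v, ∀ y ∈ Set.Icc u v, x < y → Ξ y < Ξ x := by
    intro x hx y hy hxy
    have hx0 : 0 < x := hu.trans_le hx.1
    have hy0 : 0 < y := hx0.trans hxy
    rw [hΞ]
    refine Finset.sum_lt_sum (fun l _ => ?_) ⟨⟨1, by omega⟩, Finset.mem_univ _, ?_⟩
    · -- termwise `≤`
      rcases Nat.eq_zero_or_pos (l : ℕ) with h0 | hpos
      · have : l = ⟨0, by omega⟩ := Fin.ext h0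
        rw [this, Nat.sub_self]; simp
      · have hanti := antitoneOn_letterSumK (by omega) d a hus l hpos hu hG hx hy hxy.le
        have hcast : 0 ≤ ((d l - d ⟨0, by omega⟩ : ℕ) : ℝ) := Nat.cast_nonneg _
        by_cases hlt : (l : ℕ) < K - 1
        · have hAx : 0 < A l x := hA x hx l hpos hlt
          have hAy : 0 < A l y := hA y hy l hpos hlt
          have hinv : (y ^ (d top - d l))⁻¹ ≤ (x ^ (d top - d l))⁻¹ :=
            inv_anti₀ (pow_pos hx0 _) (pow_le_pow_left₀ hx0.le hxy.le _)
          have hyinv : 0 ≤ (y ^ (d top - d l))⁻¹ := inv_nonneg.mpr (pow_nonneg hy0.le _)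
          calc ((d l - d ⟨0, by omega⟩ : ℕ) : ℝ) * (y ^ (d top - d l))⁻¹ * A l y
              ≤ ((d l - d ⟨0, by omega⟩ : ℕ) : ℝ) * (y ^ (d top - d l))⁻¹ * A l x :=
                mul_le_mul_of_nonneg_left hanti (mul_nonneg hcast hyinv)
            _ ≤ ((d l - d ⟨0, by omega⟩ : ℕ) : ℝ) * (x ^ (d top - d l))⁻¹ * A l x := by
                have := mul_le_mul_of_nonneg_left hinv hcast
                nlinarith
        · have hl : l = top := Fin.ext (by rw [htop]; have := l.isLt; simp; omega)
          subst hl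
          rw [Nat.sub_self]
          simp only [pow_zero, inv_one, mul_one]
          exact mul_le_mul_of_nonneg_left hanti hcast
    · -- strict at the middle letter `l = 1`
      have h1 : 0 < ((⟨1, by omega⟩ : Fin K) : ℕ) := by simp
      have h1' : ((⟨1, by omega⟩ : Fin K) : ℕ) < K - 1 := by simp; omega
      have hanti := antitoneOn_letterSumK (by omega) d a hus ⟨1, by omega⟩ h1 hu hG hx hy hxy.le
      have hAx : 0 < A ⟨1, by omega⟩ x := hA x hx _ h1 h1'
      have hAy : 0 < A ⟨1, by omega⟩ y := hA y hy _ h1 h1'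
      have hk : 0 < d top - d ⟨1, by omega⟩ := by
        have : d ⟨1, by omega⟩ < d top := hd (Fin.mk_lt_mk.mpr (by omega))
        omega
      have he : 0 < ((d ⟨1, by omega⟩ - d ⟨0, by omega⟩ : ℕ) : ℝ) := by
        have : d ⟨0, by omega⟩ < d ⟨1, by omega⟩ := hd (Fin.mk_lt_mk.mpr (by omega))
        exact_mod_cast (show 0 < d ⟨1, by omega⟩ - d ⟨0, by omega⟩ by omega)
      have hinv : (y ^ (d top - d ⟨1, by omega⟩))⁻¹ < (x ^ (d top - d ⟨1, by omega⟩))⁻¹ :=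
        inv_strictAnti₀ (pow_pos hx0 _) (pow_lt_pow_left₀ hxy hx0.le hk.ne')
      have hyinv : 0 ≤ (y ^ (d top - d ⟨1, by omega⟩))⁻¹ := inv_nonneg.mpr (pow_nonneg hy0.le _)
      calc ((d ⟨1, by omega⟩ - d ⟨0, by omega⟩ : ℕ) : ℝ) * (y ^ (d top - d ⟨1, by omega⟩))⁻¹ * A ⟨1, by omega⟩ y
          ≤ ((d ⟨1, by omega⟩ - d ⟨0, by omega⟩ : ℕ) : ℝ) * (y ^ (d top - d ⟨1, by omega⟩))⁻¹ * A ⟨1, by omega⟩ x :=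
            mul_le_mul_of_nonneg_left hanti (mul_nonneg he.le hyinv)
        _ < ((d ⟨1, by omega⟩ - d ⟨0, by omega⟩ : ℕ) : ℝ) * (x ^ (d top - d ⟨1, by omega⟩))⁻¹ * A ⟨1, by omega⟩ x := by
            have := mul_lt_mul_of_pos_left hinv he
            nlinarith
  -- every root in `[u,v]` is a zero of `Ξ`
  have hroot : ∀ t, t ∈ ((∑ j, (∑ l, C (a j l * ((d l : ℝ) - d ⟨0, by omega⟩)) * X ^ (d l)) *
      ∏ i ∈ Finset.univ.erase j, (∑ l, C (a i l) * X ^ (d l)) : ℝ[X]).roots.toFinset.filter (fun t => u ≤ t ∧ t ≤ v)) →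
      Ξ t = 0 := by
    intro t ht
    rw [Finset.mem_filter, Multiset.mem_toFinset] at ht
    obtain ⟨hrt, htI⟩ := ht
    have htI' : t ∈ Set.Icc u v := htI
    have ht0 : 0 < t := hu.trans_le htI.1
    have hev := (mem_roots (ne_zero_of_mem_roots hrt)).mp hrt
    have hz := (eulerNumeratorK_eval_eq_zero_iff (by omega) d hd a ht0 (hG t htI')).mp hev
    rw [hΞrel t ht0] at hz
    exact (mul_eq_zero.mp hz).resolve_left (pow_ne_zero _ ht0.ne')
  rw [Finset.card_le_one]
  intro t₁ ht₁ t₂ ht₂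
  have h1 := hroot t₁ ht₁
  have h2 := hroot t₂ ht₂
  have ht₁I : t₁ ∈ Set.Icc u v := (Finset.mem_filter.mp ht₁).2
  have ht₂I : t₂ ∈ Set.Icc u v := (Finset.mem_filter.mp ht₂).2
  by_contra hne
  rcases lt_or_gt_of_ne hne with h | h
  · have := hΞanti t₁ ht₁I t₂ ht₂I h; linarith
  · have := hΞanti t₂ ht₂I t₁ ht₁I h; linarith

/-- ★ **(K3, upper letter sums negative)** `K ≥ 3`, strictly increasing support, UPPER-SIGNED company, pole-free interval
`[u,v] ⊂ (0,∞)` on which `A_l < 0` for every letter `l ≥ 2`: the c-free Euler numerator at the bottom coupling has AT MOST ONE zero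
in `[u,v]`. [this file's theorem] -/
theorem eulerNumeratorK_roots_Icc_le_one_of_letterSums_neg {m K : ℕ} (hK : 3 ≤ K) (d : Fin K → ℕ) (hd : StrictMono d)
    (a : Fin m → Fin K → ℝ) (hus : ∀ j (l l' : Fin K), 0 < (l : ℕ) → 0 < (l' : ℕ) → 0 ≤ a j l * a j l')
    {u v : ℝ} (hu : 0 < u) (hG : ∀ x ∈ Set.Icc u v, ∀ j, (∑ l', a j l' * x ^ (d l' - d ⟨0, by omega⟩)) ≠ 0)
    (hA : ∀ x ∈ Set.Icc u v, ∀ l : Fin K, 2 ≤ (l : ℕ) → ∑ j, a j l / ∑ l', a j l' * x ^ (d l' - d ⟨0, by omega⟩) < 0) :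
    ((∑ j, (∑ l, C (a j l * ((d l : ℝ) - d ⟨0, by omega⟩)) * X ^ (d l)) *
      ∏ i ∈ Finset.univ.erase j, (∑ l, C (a i l) * X ^ (d l)) : ℝ[X]).roots.toFinset.filter (fun t => u ≤ t ∧ t ≤ v)).card ≤ 1 := by
  classical
  set one : Fin K := ⟨1, by omega⟩ with hone
  set A : Fin K → ℝ → ℝ := fun l y => ∑ j, a j l / ∑ l', a j l' * y ^ (d l' - d ⟨0, by omega⟩) with hAdef
  -- the normalised function `Ξ(x) = Σ_{l ≥ 1} e_l x^{d_l − d_1} A_l(x)` (the `l = 0` term vanishes: `e_0 = 0`)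
  set Ξ : ℝ → ℝ := fun y => ∑ l, ((d l - d ⟨0, by omega⟩ : ℕ) : ℝ) * y ^ (d l - d one) * A l y with hΞ
  have hΞrel : ∀ x, 0 < x → (∑ l, ((d l - d ⟨0, by omega⟩ : ℕ) : ℝ) * x ^ (d l - d ⟨0, by omega⟩) * A l x)
      = x ^ (d one - d ⟨0, by omega⟩) * Ξ x := by
    intro x hx
    rw [hΞ, Finset.mul_sum]
    refine Finset.sum_congr rfl fun l _ => ?_
    rcases Nat.eq_zero_or_pos (l : ℕ) with h0 | hpos
    · have : l = ⟨0, by omega⟩ := Fin.ext h0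
      rw [this, Nat.sub_self]; simp
    · have h1l : d one ≤ d l := hd.monotone (Fin.mk_le_mk.mpr (by omega) : one ≤ l)
      have h01 : d ⟨0, by omega⟩ ≤ d one := hd.monotone (Fin.mk_le_mk.mpr (by omega) : (⟨0, by omega⟩ : Fin K) ≤ one)
      have hpow : x ^ (d l - d ⟨0, by omega⟩) = x ^ (d one - d ⟨0, by omega⟩) * x ^ (d l - d one) := by
        rw [← pow_add]; congr 1; omega
      rw [hpow]; ring
  -- `Ξ` is strictly antitone on `[u,v]`
  have hΞanti : ∀ x ∈ Set.Icc u v, ∀ y ∈ Set.Icc u v, x < y → Ξ y < Ξ x := by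
    intro x hx y hy hxy
    have hx0 : 0 < x := hu.trans_le hx.1
    have hy0 : 0 < y := hx0.trans hxy
    rw [hΞ]
    refine Finset.sum_lt_sum (fun l _ => ?_) ⟨⟨2, by omega⟩, Finset.mem_univ _, ?_⟩
    · rcases Nat.eq_zero_or_pos (l : ℕ) with h0 | hpos
      · have : l = ⟨0, by omega⟩ := Fin.ext h0
        rw [this, Nat.sub_self]; simp
      · have hanti := antitoneOn_letterSumK (by omega) d a hus l hpos hu hG hx hy hxy.le
        have hcast : 0 ≤ ((d l - d ⟨0, by omega⟩ : ℕ) : ℝ) := Nat.cast_nonneg _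
        by_cases h2 : 2 ≤ (l : ℕ)
        · have hAx : A l x < 0 := hA x hx l h2
          have hAy : A l y < 0 := hA y hy l h2
          have hpow : x ^ (d l - d one) ≤ y ^ (d l - d one) := pow_le_pow_left₀ hx0.le hxy.le _
          have hypos : 0 ≤ y ^ (d l - d one) := pow_nonneg hy0.le _
          calc ((d l - d ⟨0, by omega⟩ : ℕ) : ℝ) * y ^ (d l - d one) * A l y
              ≤ ((d l - d ⟨0, by omega⟩ : ℕ) : ℝ) * y ^ (d l - d one) * A l x :=
                mul_le_mul_of_nonneg_left hanti (mul_nonneg hcast hypos)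
            _ ≤ ((d l - d ⟨0, by omega⟩ : ℕ) : ℝ) * x ^ (d l - d one) * A l x := by
                have := mul_le_mul_of_nonpos_right hpow hAx.le
                nlinarith
        · have hl : l = one := Fin.ext (by rw [hone]; simp; omega)
          subst hl
          rw [Nat.sub_self]
          simp only [pow_zero, mul_one]
          exact mul_le_mul_of_nonneg_left hanti hcast
    · -- strict at the letter `l = 2`
      have h2 : 2 ≤ ((⟨2, by omega⟩ : Fin K) : ℕ) := by simp
      have h2' : 0 < ((⟨2, by omega⟩ : Fin K) : ℕ) := by simp
      have hanti := antitoneOn_letterSumK (by omega) d a hus ⟨2, by omega⟩ h2' hu hG hx hy hxy.le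
      have hAx : A ⟨2, by omega⟩ x < 0 := hA x hx _ h2
      have hAy : A ⟨2, by omega⟩ y < 0 := hA y hy _ h2
      have hk : 0 < d ⟨2, by omega⟩ - d one := by
        have : d one < d ⟨2, by omega⟩ := hd (Fin.mk_lt_mk.mpr (by omega))
        omega
      have he : 0 < ((d ⟨2, by omega⟩ - d ⟨0, by omega⟩ : ℕ) : ℝ) := by
        have : d ⟨0, by omega⟩ < d ⟨2, by omega⟩ := hd (Fin.mk_lt_mk.mpr (by omega))
        exact_mod_cast (show 0 < d ⟨2, by omega⟩ - d ⟨0, by omega⟩ by omega)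
      have hpow : x ^ (d ⟨2, by omega⟩ - d one) < y ^ (d ⟨2, by omega⟩ - d one) := pow_lt_pow_left₀ hxy hx0.le hk.ne'
      have hypos : 0 ≤ y ^ (d ⟨2, by omega⟩ - d one) := pow_nonneg hy0.le _
      calc ((d ⟨2, by omega⟩ - d ⟨0, by omega⟩ : ℕ) : ℝ) * y ^ (d ⟨2, by omega⟩ - d one) * A ⟨2, by omega⟩ y
          ≤ ((d ⟨2, by omega⟩ - d ⟨0, by omega⟩ : ℕ) : ℝ) * y ^ (d ⟨2, by omega⟩ - d one) * A ⟨2, by omega⟩ x :=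
            mul_le_mul_of_nonneg_left hanti (mul_nonneg he.le hypos)
        _ < ((d ⟨2, by omega⟩ - d ⟨0, by omega⟩ : ℕ) : ℝ) * x ^ (d ⟨2, by omega⟩ - d one) * A ⟨2, by omega⟩ x := by
            have := mul_lt_mul_of_neg_right hpow hAx
            nlinarith
  have hroot : ∀ t, t ∈ ((∑ j, (∑ l, C (a j l * ((d l : ℝ) - d ⟨0, by omega⟩)) * X ^ (d l)) *
      ∏ i ∈ Finset.univ.erase j, (∑ l, C (a i l) * X ^ (d l)) : ℝ[X]).roots.toFinset.filter (fun t => u ≤ t ∧ t ≤ v)) →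
      Ξ t = 0 := by
    intro t ht
    rw [Finset.mem_filter, Multiset.mem_toFinset] at ht
    obtain ⟨hrt, htI⟩ := ht
    have htI' : t ∈ Set.Icc u v := htI
    have ht0 : 0 < t := hu.trans_le htI.1
    have hev := (mem_roots (ne_zero_of_mem_roots hrt)).mp hrt
    have hz := (eulerNumeratorK_eval_eq_zero_iff (by omega) d hd a ht0 (hG t htI')).mp hev
    rw [hΞrel t ht0] at hz
    exact (mul_eq_zero.mp hz).resolve_left (pow_ne_zero _ ht0.ne')
  rw [Finset.card_le_one]
  intro t₁ ht₁ t₂ ht₂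
  have h1 := hroot t₁ ht₁
  have h2 := hroot t₂ ht₂
  have ht₁I : t₁ ∈ Set.Icc u v := (Finset.mem_filter.mp ht₁).2
  have ht₂I : t₂ ∈ Set.Icc u v := (Finset.mem_filter.mp ht₂).2
  by_contra hne
  rcases lt_or_gt_of_ne hne with h | h
  · have := hΞanti t₁ ht₁I t₂ ht₂I h; linarith
  · have := hΞanti t₂ ht₂I t₁ ht₁I h; linarith

end ProductPlusOne

end Summit.ValiantsHypothesis.ValiantsHypothesis.Theorems.LacunarySymmetroidMatrixDescartes
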